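import Summits.QuantumAdvantage.QuantumAdvantage.Theorems.NearExactIsExact.Negative.SkewProductCore

/-!
# `NearExactIsExact` (stmt-QuantumAdvantage-14043) — negative lemma: the REFLECTED QUADRUPLE
  (gen 42 disprover; THEOREM K4 — every K-model over a 4-bit base is empty, one-sidedly, census-free:
  the first theorem INSIDE the `naff = 4` stratum of BQ-11)

Fourth member of the reflected-pair family (`ReflectedFlatPair`: `naff = 5` K-frames; `ReflectedPairGraph`:
γ-frames; `ReflectedPairSix`: 6-flats).  The pattern generalises: a K-model over an `a`-bit base with an
inversion-linear fibre action and residual `{0̄} × V_s`, `codim V_s = r`, carries the certificate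
`Φ = Σ_{e ∈ E} 1_{S_e}` with `E` a complement of `V_s` (`|E| = 2^r`) and `S_e = {(ū, K(ū)⁻¹e)}` affine
`a`-flats: the source side needs `a ≥ 4`, the target side `Σ_{e∈E} c₂(· ⊕ e)` is an `r`-th derivative of a
cubic (degree `3 − r`) composed with the quadratic graph of `p`, so it needs `2(3 − r) < a`; the mass is
`|E ∩ V_s| = 1`.  At `naff = 5` (`a = 5, r = 1`) this is the reflected flat pair; at `naff = 4` (`a = 4`,
`r = 2`: block `𝔽₂⁷`, residual a codimension-2 flat) it is the REFLECTED QUADRUPLE below, with room to spare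
(`2·1 = 2 < 4`).

**THEOREM (`reflected_quad`, any `n`, any `π`).** `c₁, c₂` cubic with `c₁ ⊕ c₂∘π = U`; `σ₀, σ₁, σ₂, σ₃ :
𝔽₂⁴ → 𝔽₂^n` affine; `π∘σ₀` quadratic; `π∘σ₁ = π∘σ₀ ⊕ e₁`, `π∘σ₂ = π∘σ₀ ⊕ e₂`, `π∘σ₃ = π∘σ₀ ⊕ e₁ ⊕ e₂`.
Then the total `U`-mass of the four flats is even.  (Cubics vanish on 4-flats; `Σ_{e∈E} c₂(y ⊕ e) =
Δ_{e₁}Δ_{e₂}c₂(y)` is affine, composed with a quadratic it has degree `≤ 2 ≤ 3 < 4`, Ax at `(4,3)`.)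

**COROLLARY (`kfour_empty`, THEOREM K4).** Source `(ū, s) ∈ 𝔽₂^{4+7}`, residual `[ū = 0]·V(s)` with
`V(0) = true`; if the zero section has a quadratic image and three AFFINE sections `t₁, t₂, t₃` are its
reflections through `e₁, e₂, e₁ ⊕ e₂` with `V(t_k(0)) = false`, there is no cubic pair.  For
`π(ū,s) = (ū, p(ū) ⊕ K(ū)s)` with `K` inversion-linear this holds for EVERY quadratic `p` (no two-sidedness
needed) and EVERY codimension-2 subspace `V_s` (`t_e = K⁻¹e`, `e` over a complement `E` of `V_s`).
Exact numerics (folder `k4/`): two-sided `naff = 4` K-models exist (random 2-generator modules over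
`𝔽₂[a₁..a₄]/(a_i²)`, `K(ū)` = multiplication by `1 + Σu_c a_c`, `p` from the translation condition:
6/116 modules give `naff(π) = naff(π⁻¹) = 4`, `deg π = deg π⁻¹ = 2` — the first two-sided `naff = 4` maps
in the cell) and all 48 + 32 (one-sided) sampled residual instances are dead, as the theorem says.

HONEST FRAMING: a kernel-checked negative lemma closing a thin algebraic sub-family (fibre-affine over the
4-bit base) of the open `naff = 4` stratum; the general `naff = 4` map is only fibre-affine over the 6-bit
frame (D2) and is NOT covered; NOT summit progress.
-/

set_option linter.dupNamespace false -- D-0017: single-problem summit ⇒ `QuantumAdvantage.QuantumAdvantage` by design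

namespace Summit.QuantumAdvantage.QuantumAdvantage.Theorems.NearExactIsExact.Negative.ReflectedQuad

open Finset
open Literature.Computability.QuantumComplexity
open Literature.Computability.QuantumComplexity.BuzetChailloux (bxor)
open Summit.QuantumAdvantage.QuantumAdvantage.Theorems.CubicForrelation.NearExactIsExact
  (fc_isDegLeFun_comp fc_sum_signOf_eq_card stub_axParity stub_derivDegree)
open Summit.QuantumAdvantage.QuantumAdvantage.Theorems.NearExactIsExact.Negative.BqqSeven
  (natCast_eq_zero_of_even)
open Summit.QuantumAdvantage.QuantumAdvantage.Theorems.NearExactIsExact.Negative.SkewProductCore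

/-- Ax / McEliece at `n = 4`, `d = 3`: a Boolean function of degree `≤ 3` on `4` bits has even weight.
[folklore] -/
theorem even_card_of_deg_three {F : (Fin 4 → Bool) → Bool} (hF : IsDegLeFun 3 F) :
    Even ((univ.filter fun x : Fin 4 → Bool => F x = true).card) := by
  obtain ⟨z, hz⟩ := stub_axParity 4 3 F univ (by norm_num) hF
  rw [filter_true_of_mem (fun u _ i _ => mem_univ i), card_fin, fc_sum_signOf_eq_card] at hz
  have h4 : (2 : ℝ) ^ ((4 + 3 - 1) / 3) = 4 := by norm_num
  rw [h4] at hz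
  have hc : (((univ.filter fun x : Fin 4 → Bool => F x = true).card : ℤ) : ℝ) =
      ((2 * (4 - z) : ℤ) : ℝ) := by
    push_cast
    linear_combination (-(1 : ℝ) / 2) * hz
  have he : Even (((univ.filter fun x : Fin 4 → Bool => F x = true).card : ℤ)) :=
    ⟨4 - z, by rw [Int.cast_injective hc]; ring⟩
  exact (Int.even_coe_nat _).mp he

/-- Degree `≤ 3` on `4` bits ⇒ `Σ_x ind (F x) = 0`. [folklore] -/
theorem sum_ind_eq_zero_of_deg_three {F : (Fin 4 → Bool) → Bool} (hF : IsDegLeFun 3 F) :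
    ∑ x, ind (F x) = 0 := by
  rw [sum_ind]
  exact natCast_eq_zero_of_even (even_card_of_deg_three hF)

/-- **REFLECTED QUADRUPLE.** `c₁ ⊕ c₂∘π = U`, `c₁, c₂` cubic, `σ₀..σ₃ : 𝔽₂⁴ → 𝔽₂^n` affine, `π∘σ₀`
quadratic, `π∘σ_k = π∘σ₀ ⊕ (e₁, e₂, e₁ ⊕ e₂)_k` ⇒ the total `U`-mass of the four flats is even.
[folklore] -/
theorem reflected_quad {n : ℕ} (π : (Fin n → Bool) → (Fin n → Bool))
    (c₁ c₂ : (Fin n → Bool) → Bool) (h₁ : IsDegLeFun 3 c₁) (h₂ : IsDegLeFun 3 c₂)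
    (U : (Fin n → Bool) → Bool) (hres : ∀ z, (c₁ z ^^ c₂ (π z)) = U z)
    (σ₀ σ₁ σ₂ σ₃ : (Fin 4 → Bool) → (Fin n → Bool))
    (hσ₀ : ∀ j, IsDegLeFun 1 (fun v => σ₀ v j)) (hσ₁ : ∀ j, IsDegLeFun 1 (fun v => σ₁ v j))
    (hσ₂ : ∀ j, IsDegLeFun 1 (fun v => σ₂ v j)) (hσ₃ : ∀ j, IsDegLeFun 1 (fun v => σ₃ v j))
    (hπ : ∀ j, IsDegLeFun 2 (fun v => π (σ₀ v) j)) (e₁ e₂ : Fin n → Bool)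
    (hr₁ : ∀ v, π (σ₁ v) = bxor (π (σ₀ v)) e₁) (hr₂ : ∀ v, π (σ₂ v) = bxor (π (σ₀ v)) e₂)
    (hr₃ : ∀ v, π (σ₃ v) = bxor (bxor (π (σ₀ v)) e₂) e₁) :
    ∑ v, ind (U (σ₀ v)) + ∑ v, ind (U (σ₁ v)) + ∑ v, ind (U (σ₂ v)) + ∑ v, ind (U (σ₃ v)) = 0 := by
  have hc0 : IsDegLeFun 3 (fun v : Fin 4 → Bool => c₁ (σ₀ v)) := fc_isDegLeFun_comp h₁ σ₀ hσ₀ (by norm_num)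
  have hc1 : IsDegLeFun 3 (fun v : Fin 4 → Bool => c₁ (σ₁ v)) := fc_isDegLeFun_comp h₁ σ₁ hσ₁ (by norm_num)
  have hc2 : IsDegLeFun 3 (fun v : Fin 4 → Bool => c₁ (σ₂ v)) := fc_isDegLeFun_comp h₁ σ₂ hσ₂ (by norm_num)
  have hc3 : IsDegLeFun 3 (fun v : Fin 4 → Bool => c₁ (σ₃ v)) := fc_isDegLeFun_comp h₁ σ₃ hσ₃ (by norm_num)
  -- the second derivative `Δ_{e₁}Δ_{e₂} c₂` is affine; composed with the quadratic `π∘σ₀` it has degree ≤ 2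
  have hD : IsDegLeFun 3 (fun v : Fin 4 → Bool => (c₂ (π (σ₀ v)) ^^ c₂ (bxor (π (σ₀ v)) e₂)) ^^
      (c₂ (bxor (π (σ₀ v)) e₁) ^^ c₂ (bxor (bxor (π (σ₀ v)) e₁) e₂))) :=
    fc_isDegLeFun_comp (stub_derivDegree n 1 _ e₁ (stub_derivDegree n 2 c₂ e₂ h₂)) (fun v => π (σ₀ v))
      hπ (by norm_num)
  have hb : ∀ y : Fin n → Bool, bxor (bxor y e₂) e₁ = bxor (bxor y e₁) e₂ := by
    intro y; funext j; simp only [bxor]; cases y j <;> cases e₁ j <;> cases e₂ j <;> rfl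
  have hpt : ∀ v : Fin 4 → Bool, ind (U (σ₀ v)) + ind (U (σ₁ v)) + ind (U (σ₂ v)) + ind (U (σ₃ v)) =
      ind (c₁ (σ₀ v)) + ind (c₁ (σ₁ v)) + ind (c₁ (σ₂ v)) + ind (c₁ (σ₃ v)) +
        ind ((c₂ (π (σ₀ v)) ^^ c₂ (bxor (π (σ₀ v)) e₂)) ^^
          (c₂ (bxor (π (σ₀ v)) e₁) ^^ c₂ (bxor (bxor (π (σ₀ v)) e₁) e₂))) := by
    intro v
    rw [← hres (σ₀ v), ← hres (σ₁ v), ← hres (σ₂ v), ← hres (σ₃ v), hr₁ v, hr₂ v, hr₃ v, hb,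
      ind_xor, ind_xor, ind_xor, ind_xor, ind_xor, ind_xor, ind_xor]
    ring
  rw [← sum_add_distrib, ← sum_add_distrib, ← sum_add_distrib, sum_congr rfl (fun v _ => hpt v),
    sum_add_distrib, sum_add_distrib, sum_add_distrib, sum_add_distrib,
    sum_ind_eq_zero_of_deg_three hc0, sum_ind_eq_zero_of_deg_three hc1,
    sum_ind_eq_zero_of_deg_three hc2, sum_ind_eq_zero_of_deg_three hc3,
    sum_ind_eq_zero_of_deg_three hD]
  ring

/-- Coordinates of a graph flat `v ↦ (v, t v)` over a 4-bit base with `t` affine are affine. [folklore] -/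
theorem graph4_coord_deg {r : ℕ} (t : (Fin 4 → Bool) → Fin r → Bool)
    (ht : ∀ k, IsDegLeFun 1 (fun v => t v k)) :
    ∀ j : Fin (4 + r), IsDegLeFun 1 (fun v : Fin 4 → Bool => Fin.append v (t v) j) := by
  intro j
  induction j using Fin.addCases with
  | left i =>
    have e : (fun v : Fin 4 → Bool => Fin.append v (t v) (Fin.castAdd r i)) = fun v => v i :=
      funext fun v => Fin.append_left v _ i
    rw [e]; exact isDegLeFun_apply i le_rfl
  | right k =>
    have e : (fun v : Fin 4 → Bool => Fin.append v (t v) (Fin.natAdd 4 k)) = fun v => t v k :=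
      funext fun v => Fin.append_right v _ k
    rw [e]; exact ht k

/-- Mass of a graph section over the 4-bit base against the residual `[ū = 0]·V(s)`: it is `ind (V (t 0))`.
[folklore] -/
theorem section_mass (V : (Fin 7 → Bool) → Bool) (t : (Fin 4 → Bool) → Fin 7 → Bool) :
    ∑ v : Fin 4 → Bool, ind (decide (∀ i : Fin 4, Fin.append v (t v) (Fin.castAdd 7 i) = false) &&
      V (fun k => Fin.append v (t v) (Fin.natAdd 4 k))) = ind (V (t fun _ => false)) := by
  simp only [Fin.append_left, Fin.append_right]
  rw [Finset.sum_eq_single (fun _ => false)]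
  · simp
  · intro u _ hu
    have hu' : ¬ ∀ i, u i = false := fun h' => hu (funext h')
    simp [hu']
  · intro h'
    exact absurd (mem_univ _) h'

/-- **THEOREM K4 (every K-model over a 4-bit base is empty, census-free).** Source `(ū, s) ∈ 𝔽₂^{4+7}`,
residual `[ū = 0]·V(s)` with `V(0) = true`; the zero section has a quadratic image and three affine
sections `t₁, t₂, t₃` with `V(t_k(0)) = false` are its reflections through `e₁`, `e₂`, `e₁ ⊕ e₂`.  Then no
cubic pair has that residual.  (For `π(ū,s) = (ū, p(ū) ⊕ K(ū)s)`, `K` inversion-linear: `t_e = K⁻¹e` over a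
complement `E ∋ e` of the codimension-2 subspace `V`; any quadratic `p`.) [folklore] -/
theorem kfour_empty (π : (Fin (4 + 7) → Bool) → (Fin (4 + 7) → Bool))
    (c₁ c₂ : (Fin (4 + 7) → Bool) → Bool) (h₁ : IsDegLeFun 3 c₁) (h₂ : IsDegLeFun 3 c₂)
    (V : (Fin 7 → Bool) → Bool) (hV0 : V (fun _ => false) = true)
    (hres : ∀ z, (c₁ z ^^ c₂ (π z)) =
      (decide (∀ i : Fin 4, z (Fin.castAdd 7 i) = false) && V (fun k => z (Fin.natAdd 4 k))))
    (hπ : ∀ j, IsDegLeFun 2 (fun v : Fin 4 → Bool => π (Fin.append v (fun _ => false)) j))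
    (t₁ t₂ t₃ : (Fin 4 → Bool) → Fin 7 → Bool) (ht₁ : ∀ k, IsDegLeFun 1 (fun v => t₁ v k))
    (ht₂ : ∀ k, IsDegLeFun 1 (fun v => t₂ v k)) (ht₃ : ∀ k, IsDegLeFun 1 (fun v => t₃ v k))
    (hV₁ : V (t₁ fun _ => false) = false) (hV₂ : V (t₂ fun _ => false) = false)
    (hV₃ : V (t₃ fun _ => false) = false) (e₁ e₂ : Fin (4 + 7) → Bool)
    (hr₁ : ∀ v, π (Fin.append v (t₁ v)) = bxor (π (Fin.append v (fun _ => false))) e₁)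
    (hr₂ : ∀ v, π (Fin.append v (t₂ v)) = bxor (π (Fin.append v (fun _ => false))) e₂)
    (hr₃ : ∀ v, π (Fin.append v (t₃ v)) = bxor (bxor (π (Fin.append v (fun _ => false))) e₂) e₁) :
    False := by
  have h := reflected_quad π c₁ c₂ h₁ h₂ _ hres (fun v => Fin.append v (fun _ => false))
    (fun v => Fin.append v (t₁ v)) (fun v => Fin.append v (t₂ v)) (fun v => Fin.append v (t₃ v))
    (graph4_coord_deg (fun _ _ => false) (fun _ => isDegLeFun_const 1 false))
    (graph4_coord_deg t₁ ht₁) (graph4_coord_deg t₂ ht₂) (graph4_coord_deg t₃ ht₃) hπ e₁ e₂ hr₁ hr₂ hr₃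
  rw [section_mass V (fun _ _ => false), section_mass V t₁, section_mass V t₂, section_mass V t₃,
    hV0, hV₁, hV₂, hV₃, ind_true, ind_false, add_zero, add_zero, add_zero] at h
  exact one_ne_zero h

end Summit.QuantumAdvantage.QuantumAdvantage.Theorems.NearExactIsExact.Negative.ReflectedQuad
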